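import Literature.Topology.FourManifolds.SphereFamilySurgery
import Literature.AlgebraicTopology.SingularHomology.FundamentalClass
import Literature.AlgebraicTopology.SingularHomology.ExcisionMayerVietoris
import HarnessLib

/-!
# The class of a framed sphere dies in the local homology at the cores of its family

Topic `Literature/Topology/FourManifolds` (fact seat
`provefact-Literature.Topology.FourManifolds.Matvey-69322e0896`, rung (H4)
`Literature.Topology.FourManifolds.Matveyev1996_partOne_and_fact_of_dualSpheres` of
`CorkDecompositionMiddleLevel.lean`; towards the hypotheses of the surgical engine
`FramedSphereFamily.isZero_singularHomology_of_surgery_middle`, `SphereSurgeryMiddleHomology.lean`,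
Kervaire–Milnor's Lemma 7.1, for the surgeries of Matveyev's step 3).  The *isotropy*
hypothesis of that engine asks that classes invisible in the local homology
`Hₖ(X | ⋃ᵢ Sᵢ) = Hₖ(X, X ∖ ⋃ᵢ Sᵢ)` at the cores of a framed family be combinations of the
sphere classes; conversely the sphere classes themselves are invisible there — *"`λᵢ · λⱼ = 0`"*
(Kervaire–Milnor, *Groups of homotopy spheres I* (1963), Lemma 7.1: the spheres have trivial
normal bundles and are disjoint, so a sphere can be pushed off all the cores).  This file
proves that converse in the relational, universe-clean form of the tree: for a framed family
`ν` in a Hausdorff space and any `n`, **the composite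
`Hₙ(Sᵢ) → Hₙ(X) → Hₙ(X | ⋃ⱼ Sⱼ)` vanishes**, `Sᵢ = φᵢ(Sᵏ × 0) ⊆ X` the core as a subset: the
inclusion of `Sᵢ` is homotopic, through the tube `φᵢ(Sᵏ × [0, 1]v₀)`, to the parallel sphere
`φᵢ(Sᵏ × v₀)`, which misses every core, and `i_* ≫ j_* = 0` in the sequence of the pair
`(X, X ∖ ⋃ Sⱼ)` (Hatcher, *Algebraic Topology* (2002), §2.1, Thm. 2.10 and the long exact
sequence).  Everything is proved; no definitions, no named facts:

* `Literature.Topology.FourManifolds.FramedSphereFamily.homotopic_incl_range_sphere_parallel` —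
  the inclusion of the core is homotopic in `X` to a map into the complement of the cores;
* `Literature.Topology.FourManifolds.FramedSphereFamily.map_incl_range_sphere_comp_toLocalOfSet_cores`
  — `Hₙ(Sᵢ) → Hₙ(X) → Hₙ(X | ⋃ⱼ Sⱼ)` is zero.

## References

* M. Kervaire, J. Milnor, *Groups of homotopy spheres I*, Ann. of Math. 77 (1963), Lemma 7.1
  (p. 526). [KervaireMilnorAnnals1963]
* A. Hatcher, *Algebraic Topology*, CUP 2002, §2.1 (Thm. 2.10; the long exact sequence of the
  pair, Thm. 2.13 ff.), §3.3 p. 233 (`Hₙ(X | A)`). [HatcherAT2002]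
* R. Matveyev, *A decomposition of smooth simply-connected h-cobordant 4-manifolds*,
  arXiv:dg-ga/9505001, Proof of Theorem, step 3. [Matveyev1996]
-/

noncomputable section

open CategoryTheory Limits Set Function Metric
open scoped Manifold ContDiff Topology unitInterval

universe u v w

namespace Literature.Topology.FourManifolds

open Literature.AlgebraicTopology.SingularHomology

variable (R : Type v) [CommRing R] (M : Type v) [AddCommGroup M] [Module R M]

namespace FramedSphereFamily

variable {EX HX : Type*} [NormedAddCommGroup EX] [NormedSpace ℝ EX] [TopologicalSpace HX]
  {IX : ModelWithCorners ℝ EX HX} {X : Type u} [TopologicalSpace X] [T2Space X]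
  [ChartedSpace HX X] {ι : Type w} [Finite ι] {k m : ℕ}

/-- **The core sphere of a framed family is homotopic in `X` to a parallel sphere off all the
cores.**  For a framed family `ν` in a Hausdorff space, a sphere `Sᵢ = φᵢ(Sᵏ × 0)` of it and a
nonzero fibre vector `v₀`, the inclusion `Sᵢ ↪ X` is homotopic to a continuous map
`Sᵢ → X ∖ ⋃ⱼ Sⱼ` followed by the inclusion (namely `φᵢ(u, 0) ↦ φᵢ(u, v₀)`, through
`s ↦ φᵢ(u, s v₀)`; Kervaire–Milnor 1963, Lemma 7.1: a framed sphere is pushed off itself along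
the framing). [cite: KervaireMilnorAnnals1963, Lemma 7.1 (p. 526)] -/
theorem homotopic_incl_range_sphere_parallel (ν : FramedSphereFamily IX X ι k m) (i : ι)
    {v₀ : EuclideanSpace ℝ (Fin m)} (hv₀ : v₀ ≠ 0) :
    ∃ par : C(↥(range (ν.sphere i)), ↥(ν.coresᶜ)),
      (subsetIncl (range (ν.sphere i))).Homotopic ((subsetIncl ν.coresᶜ).comp par) := by
  -- the core sphere as a homeomorphic copy of `Sᵏ`
  have hemb : Topology.IsClosedEmbedding (ν.sphere i) :=
    (ν.continuous_sphere i).isClosedEmbedding (ν.injective_sphere i)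
  let e : (Metric.sphere (0 : EuclideanSpace ℝ (Fin (k + 1))) 1) ≃ₜ ↥(range (ν.sphere i)) :=
    hemb.isEmbedding.toHomeomorph
  have he : ∀ u, (e u : X) = ν.sphere i u := fun u => rfl
  have he' : ∀ z : ↥(range (ν.sphere i)), ν.sphere i (e.symm z) = z := fun z => by
    rw [← he, e.apply_symm_apply]
  -- the parallel sphere
  have hmem : ∀ u, ν.toFun i (u, v₀) ∈ ν.coresᶜ := fun u => ν.apply_mem_complement i u hv₀
  let par : C(↥(range (ν.sphere i)), ↥(ν.coresᶜ)) :=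
    ⟨fun z => ⟨ν.toFun i (e.symm z, v₀), hmem _⟩,
      ((ν.continuous i).comp ((e.symm.continuous).prodMk continuous_const)).subtype_mk _⟩
  refine ⟨par, ⟨?_⟩⟩
  -- the homotopy `(s, z) ↦ φᵢ(e⁻¹ z, s v₀)`
  refine
    { toFun := fun p => ν.toFun i (e.symm p.2, (p.1 : ℝ) • v₀)
      continuous_toFun := (ν.continuous i).comp ((e.symm.continuous.comp continuous_snd).prodMk
        ((continuous_subtype_val.comp continuous_fst).smul continuous_const))
      map_zero_left := fun z => ?_
      map_one_left := fun z => ?_ }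
  · show ν.toFun i (e.symm z, ((0 : I) : ℝ) • v₀) = (z : X)
    rw [show ((0 : I) : ℝ) = 0 from rfl, zero_smul, ← ν.sphere_apply, he']
  · show ν.toFun i (e.symm z, ((1 : I) : ℝ) • v₀) = ν.toFun i (e.symm z, v₀)
    rw [show ((1 : I) : ℝ) = 1 from rfl, one_smul]

/-- **The class of a core sphere vanishes in the local homology at the cores of its family**:
for a framed family `ν` in a Hausdorff space `X` and every `n`, the composite
`Hₙ(Sᵢ; M) → Hₙ(X; M) → Hₙ(X | ⋃ⱼ Sⱼ; M)` is zero (the inclusion of `Sᵢ` factors up to homotopy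
through `X ∖ ⋃ⱼ Sⱼ`, `homotopic_incl_range_sphere_parallel`, and `i_* ≫ j_* = 0` in the long
exact sequence of the pair `(X, X ∖ ⋃ⱼ Sⱼ)`, Hatcher 2002, §2.1) — the vanishing
*"`λᵢ · λⱼ = 0`"* of Kervaire–Milnor's Lemma 7.1 for a disjoint framed family, in the local
homological form consumed by `FramedSphereFamily.isZero_singularHomology_of_surgery_middle`.
[cite: KervaireMilnorAnnals1963, Lemma 7.1 (p. 526)]
[cite: HatcherAT2002, §2.1 Thm. 2.10 and the exact sequence of the pair] -/
theorem map_incl_range_sphere_comp_toLocalOfSet_cores (ν : FramedSphereFamily IX X ι k m)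
    (i : ι) (hm : 0 < m) (n : ℕ) :
    singularHomology.map R M (subsetIncl (range (ν.sphere i))) n ≫
      singularHomology.toLocalOfSet R M X ν.cores n = 0 := by
  -- a nonzero fibre vector
  obtain ⟨v₀, hv₀⟩ : ∃ v₀ : EuclideanSpace ℝ (Fin m), v₀ ≠ 0 := by
    refine ⟨EuclideanSpace.single ⟨0, hm⟩ 1, fun h => ?_⟩
    have h1 := congrArg (fun v : EuclideanSpace ℝ (Fin m) => v ⟨0, hm⟩) h
    simp at h1
  obtain ⟨par, hpar⟩ := ν.homotopic_incl_range_sphere_parallel i hv₀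
  rw [singularHomology.map_eq_of_homotopic R M hpar n, singularHomology.map_comp, Category.assoc,
    singularHomology.toLocalOfSet, relativeSingularHomology.map_comp_ofAbsolute, comp_zero]

end FramedSphereFamily

end Literature.Topology.FourManifolds

end
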